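import Literature.MathematicalPhysics.QuantumFieldTheory.Balaban1983to89.B2Eq228Conditioning

/-!
# `Balaban1983to89.B12Eq216MeasureCovariance` — [Balaban1987RG1] (2.16) p. 269: the MEASURE CLAUSE «all the
expressions in (2.12), together with the measure, are invariant» AT MEASURE LEVEL for the tree's normalised Gaussian
`dμ_{M⁻¹} = B2Eq228Conditioning.gaussProb M` — an orthogonal transformation `B′ → R(u)B′` of the fluctuation field
carries `dμ_{C(U)}` to `dμ_{C(U^u)}` as soon as the covariance (equivalently the precision) transforms by conjugation
(PROVED; the measure-level twin of the integral-level device D5 `B13GaugeDevices.gaussMean_conj`)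

HONEST FRAMING (cell `lit-balaban`, verbatim): statement-level skeleton of published theorems with citation tags;
proofs where landed; nothing here is a claim about the Yang–Mills mass gap.

CITATION HEADER.  T. Bałaban, *Renormalization group approach to lattice gauge field theories. I. Generation of
effective actions in a small field approximation and a coupling constant renormalization in four dimensions*,
Commun. Math. Phys. **109** (1987) 249–301, doi:10.1007/bf01215223 [Balaban1987RG1] (cell paper B12 = «[I]»; held
text `paper:balaban1987-cmp109-rg-i-small-field`, journal page = PDF page + 248; p. 269 = PDF 21 re-read from the
text layer `p0021.txt` this session, the display (2.16) checked earlier by this lineage against the render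
`b2b-balaban-ref1/pages/1987-cmp109-rg-I-small-field/1987-cmp109-rg-I-small-field-p021-x2.png`).  Unit
`lit-balaban-r09` gen 43 (reader/typer of B12, display owner of SKELETON row `B12.Eq2.16`, kind C; fold owner r20);
HOME `run/shared/lean/pub/lit-balaban/`; TAKING #3 line HOME/STATUS 2026-08-23T15:06:19Z (free-target protocol G.5-34(d)).

WHAT IS PRINTED (p. 269 [PDF 21], verbatim).  *«Let us discuss briefly the gauge invariance and the Euclidean
invariance of this term. The gauge invariance was discussed already several times in the previous papers, so let us
recall only that all the expressions in (2.12), together with the measure, are invariant with respect to the gauge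
transformations
  U_{k+1} → U^u_{k+1},  B′ → R(u)B′,  (R(u)B′)(b) = R(u(b₋))B′(b).   (2.16)
The characteristic function is invariant with respect to the transformations of the fluctuation field B′, because
they are local, orthogonal transformations; therefore the expression (2.13) is gauge invariant.»*  And, for (2.18):
*«The transformation (2.18) generates an orthogonal transformation of the fluctuation field B′, hence all the
remaining operations preserve the invariance for the same reasons as for the gauge invariance.»*  The measure in
question is that of (2.11)–(2.12) p. 268: *«the measure becomes a Gaussian measure in variables B, with the covariance
C^{(k)} = C^{(k)}(U_{k+1}) = (C*Δ^{(k)}C)⁻¹»*.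

WHAT THE TREE ALREADY HOLDS (used BY NAME; nothing restated).  `B2Eq228Conditioning.gaussProb M` is the normalised
Gaussian `dμ_{M⁻¹}` on `κ → ℝ` (Lebesgue measure with density `e^{−½⟨x,Mx⟩}` divided by its integral), the measure of
record of the (2.12)/(2.13) Gaussian datum of `B12Eq213Body268` (r20; `μ U := gaussProb (prec U)`).
`B13GaugeDevices` §H.5 holds the INTEGRAL-level devices for an orthogonal `R` (`Rᵀ R = 1`): Lebesgue measure is
invariant (`integral_comp_mulVec_of_transpose_mul_self`), `gaussWeight_conj` ∕ `gaussNorm_conj` ∕ `gaussMean_conj`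
(`∫dμ_{(RARᵀ)⁻¹}Ψ = ∫dμ_{A⁻¹}Ψ(R·)`, device D5), `inv_conj` (`(RARᵀ)⁻¹ = RA⁻¹Rᵀ`), `abs_det_eq_one_of_transpose_mul_self`,
`mul_transpose_self_of_transpose_mul_self`.  `B12Eq213Body268.FluctData.integral_eq_of_covariant` (r20 g45, p. 269
mechanism) takes the measure clause as the HYPOTHESIS `hμ : ∀ U, (D.μ U).map e = D.μ (τ U)` for a measurable
equivalence `e` of the fluctuation variables; this file supplies exactly that shape for Gaussian measures.

WHAT THIS FILE ADDS (kernel-checked; 0 `sorry`; no named `Prop` fact; one `def` with body).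
* §1 «LOCAL, ORTHOGONAL TRANSFORMATIONS» OF THE FLUCTUATION FIELD as measurable equivalences: `rotEquiv R hR :
  (κ → ℝ) ≃ᵐ (κ → ℝ)`, `B ↦ R B` with inverse `B ↦ Rᵀ B` (print's `R(u)`, and the orthogonal map generated by (2.18));
  `dotProduct_rotEquiv` (orthogonality).
* §2 `volume_map_rotEquiv`: Lebesgue measure `dB′` is invariant (Mathlib's `Real.map_matrix_volume_pi_eq_smul_volume_pi`
  at `|det R| = 1`).
* §3 **`map_rotEquiv_gaussProb`: `(dμ_{A⁻¹}).map R = dμ_{(RARᵀ)⁻¹}`** — the normalised Gaussian with precision `A` is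
  carried by `R` to the one with precision `RARᵀ` (density `gaussWeight_conj`, normalisation `gaussNorm_conj`,
  `GaussianToolkit.map_withDensity_equiv`); covariance form `map_rotEquiv_gaussProb_of_cov`
  (`(dμ_C).map R = dμ_{RCRᵀ}`); the integral form `integral_gaussProb_conj` (= D5 read through `gaussProb`).
* §4 **THE MEASURE CLAUSE OF (2.16)**: for a family of precisions `prec : X → Matrix κ κ ℝ` over the backgrounds
  `U : X` and a background map `τ` (`U ↦ U^u`, or `r` of (2.17)) with `prec (τ U) = R · prec U · Rᵀ` —
  **`gaussProb_map_covariant`: `(dμ_U).map R = dμ_{τU}`**, literally the `hμ` of `FluctData.integral_eq_of_covariant`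
  for `μ U := gaussProb (prec U)` and `e := rotEquiv R hR`; covariance form `gaussProb_map_covariant_of_cov`
  (`C(τU) = R C(U) Rᵀ`); and the invariance of every jointly invariant integral against it,
  `integral_gaussProb_covariant` (*«therefore the expression (2.13) is gauge invariant»* at the Gaussian measure, for
  ANY integrand with `F(τU, RB) = F(U, B)` — e.g. `χ_k e^{𝐏+{…}}`).
* §5 PRINT'S PRECISION `C*Δ^{(k)}(U)C` (the letters `Cᵀ · Δ(U) · C` of `B12Eq213Body268.prec212_def`): if `Δ^{(k)}`
  is covariant, `Δ(τU) = R₁ Δ(U) R₁ᵀ`, and the elimination map intertwines the two orthogonal actions,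
  `C R₂ = R₁ C` (the fluctuation variables `B` and `B′ = CB` both transform by `R(u)`), then
  `Cᵀ Δ(τU) C = R₂ (Cᵀ Δ(U) C) R₂ᵀ` (`sandwich_conj_of_intertwine`, `prec_sandwich_covariant`) and hence
  **`gaussProb_sandwich_map_covariant`: `(dμ_{C^{(k)}(U)}).map R₂ = dμ_{C^{(k)}(τU)}`** for print's Gaussian.

NOT CLAIMED.  Which matrices `R(u)`, `R₁`, `R₂` realise (2.16)/(2.18) on the tree's carriers and THAT print's
operators `Δ^{(k)}(U)`, `C` satisfy the covariance ∕ intertwining hypotheses are the located members of row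
`B12.Eq2.16` (`B12ChiInvariance269`, `B12Average012QtildeCovariance`, `B12RTGaugeInvariance254`) and of [13]
((3.27)–(3.34)), not this file; nor is the invariance of the other terms of (2.12).  The hypotheses are explicit
binders, never facts.
-/

noncomputable section

open MeasureTheory Matrix
open scoped ENNReal

namespace Literature.MathematicalPhysics.QuantumFieldTheory.Balaban1983to89.B12Eq216MeasureCovariance

open B13GaugeDevices (gaussWeight gaussNorm gaussWeight_conj gaussNorm_conj dotProduct_conj inv_conj
  mul_transpose_self_of_transpose_mul_self abs_det_eq_one_of_transpose_mul_self isUnit_det_of_transpose_mul_self)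
open B2Eq228Conditioning (gaussProb)

variable {κ : Type} [Fintype κ] [DecidableEq κ]

/-! ## §1  «local, orthogonal transformations» of the fluctuation field as measurable equivalences -/

/-- **`B′ → R B′` as a measurable equivalence of the fluctuation variables**, for an orthogonal matrix `R`
(`Rᵀ R = 1`; print's `R(u)` of (2.16), `(R(u)B′)(b) = R(u(b₋))B′(b)`, and the orthogonal transformation generated by
(2.18)); the inverse is `B′ ↦ Rᵀ B′`. [cite: Balaban1987RG1, (2.16) p.269] -/
def rotEquiv (R : Matrix κ κ ℝ) (hR : Rᵀ * R = 1) : (κ → ℝ) ≃ᵐ (κ → ℝ) where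
  toFun B := R *ᵥ B
  invFun B := Rᵀ *ᵥ B
  left_inv B := by
    show Rᵀ *ᵥ (R *ᵥ B) = B
    rw [mulVec_mulVec, hR, one_mulVec]
  right_inv B := by
    show R *ᵥ (Rᵀ *ᵥ B) = B
    rw [mulVec_mulVec, mul_transpose_self_of_transpose_mul_self R hR, one_mulVec]
  measurable_toFun := (continuous_const.matrix_mulVec continuous_id).measurable
  measurable_invFun := (continuous_const.matrix_mulVec continuous_id).measurable

/-- `(R(u)B′) = R B′` (unfolding). [cite: Balaban1987RG1, (2.16) p.269] -/
@[simp] theorem rotEquiv_apply (R : Matrix κ κ ℝ) (hR : Rᵀ * R = 1) (B : κ → ℝ) : rotEquiv R hR B = R *ᵥ B := rfl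

/-- The inverse transformation is `B′ ↦ Rᵀ B′` (unfolding). [cite: Balaban1987RG1, (2.16) p.269] -/
@[simp] theorem rotEquiv_symm_apply (R : Matrix κ κ ℝ) (hR : Rᵀ * R = 1) (B : κ → ℝ) :
    (rotEquiv R hR).symm B = Rᵀ *ᵥ B := rfl

/-- The underlying map is `B ↦ R B`. [cite: Balaban1987RG1, (2.16) p.269] -/
theorem coe_rotEquiv (R : Matrix κ κ ℝ) (hR : Rᵀ * R = 1) : ⇑(rotEquiv R hR) = fun B => R *ᵥ B := rfl

/-- The underlying map is Mathlib's `Matrix.toLin' R`. [cite: Balaban1987RG1, (2.16) p.269] -/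
theorem coe_rotEquiv_eq_toLin' (R : Matrix κ κ ℝ) (hR : Rᵀ * R = 1) :
    ⇑(rotEquiv R hR) = ⇑(Matrix.toLin' R) :=
  funext fun B => (Matrix.toLin'_apply R B).symm

/-- *«orthogonal transformations»*: `⟨RB, RB′⟩ = ⟨B, B′⟩`. [cite: Balaban1987RG1, (2.16) p.269] -/
theorem dotProduct_rotEquiv (R : Matrix κ κ ℝ) (hR : Rᵀ * R = 1) (B B' : κ → ℝ) :
    rotEquiv R hR B ⬝ᵥ rotEquiv R hR B' = B ⬝ᵥ B' :=
  dotProduct_conj R hR B B'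

/-- The quadratic form of a conjugated matrix at the rotated field: `⟨RB, (RARᵀ)(RB)⟩ = ⟨B, AB⟩`.
[cite: Balaban1987RG1, (2.16) p.269] -/
theorem quadForm_rotEquiv (R A : Matrix κ κ ℝ) (hR : Rᵀ * R = 1) (B : κ → ℝ) :
    rotEquiv R hR B ⬝ᵥ ((R * A * Rᵀ) *ᵥ rotEquiv R hR B) = B ⬝ᵥ (A *ᵥ B) :=
  B13GaugeDevices.quadForm_conj R A hR B

/-! ## §2  Lebesgue measure `dB′` is invariant under an orthogonal transformation -/

/-- `dB′` is invariant: `volume.map (B ↦ RB) = volume` for `Rᵀ R = 1` (`|det R| = 1` in Mathlib's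
`Real.map_matrix_volume_pi_eq_smul_volume_pi`). [cite: Balaban1987RG1, (2.16) p.269] -/
theorem volume_map_mulVec (R : Matrix κ κ ℝ) (hR : Rᵀ * R = 1) :
    (volume : Measure (κ → ℝ)).map (fun B => R *ᵥ B) = volume := by
  have hdet : R.det ≠ 0 := (isUnit_det_of_transpose_mul_self R hR).ne_zero
  have hfun : (⇑(Matrix.toLin' R) : (κ → ℝ) → κ → ℝ) = fun B => R *ᵥ B := funext fun B => Matrix.toLin'_apply R B
  have h := Real.map_matrix_volume_pi_eq_smul_volume_pi hdet
  rw [hfun] at h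
  rw [h, abs_inv, abs_det_eq_one_of_transpose_mul_self R hR, inv_one, ENNReal.ofReal_one, one_smul]

/-- The same for the measurable equivalence `rotEquiv`. [cite: Balaban1987RG1, (2.16) p.269] -/
theorem volume_map_rotEquiv (R : Matrix κ κ ℝ) (hR : Rᵀ * R = 1) :
    (volume : Measure (κ → ℝ)).map ⇑(rotEquiv R hR) = volume :=
  volume_map_mulVec R hR

/-! ## §3  The normalised Gaussian under an orthogonal transformation: `(dμ_{A⁻¹}).map R = dμ_{(RARᵀ)⁻¹}` -/

/-- **`(dμ_{A⁻¹}).map R = dμ_{(RARᵀ)⁻¹}`** — the normalised Gaussian with precision `A` is carried by the orthogonal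
`B ↦ RB` to the normalised Gaussian with precision `RARᵀ` (for EVERY real matrix `A`; both sides are the same junk
when `A` is degenerate): the density transforms by `gaussWeight_conj`, the normalisation by `gaussNorm_conj`, and
`dB′` is invariant.  The measure-level form of the device D5 `B13GaugeDevices.gaussMean_conj`.
[cite: Balaban1987RG1, (2.16) p.269] -/
theorem map_rotEquiv_gaussProb (R A : Matrix κ κ ℝ) (hR : Rᵀ * R = 1) :
    (gaussProb A).map ⇑(rotEquiv R hR) = gaussProb (R * A * Rᵀ) := by
  rw [gaussProb, gaussProb, Measure.map_smul, GaussianToolkit.map_withDensity_equiv, volume_map_rotEquiv,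
    gaussNorm_conj R A hR]
  congr 1
  refine congrArg _ (funext fun y => ?_)
  simp only [Function.comp_apply, rotEquiv_symm_apply]
  rw [← gaussWeight_conj R A hR (Rᵀ *ᵥ y), mulVec_mulVec, mul_transpose_self_of_transpose_mul_self R hR,
    one_mulVec]

/-- The same with the bare map `B ↦ RB`. [cite: Balaban1987RG1, (2.16) p.269] -/
theorem map_mulVec_gaussProb (R A : Matrix κ κ ℝ) (hR : Rᵀ * R = 1) :
    (gaussProb A).map (fun B => R *ᵥ B) = gaussProb (R * A * Rᵀ) :=
  map_rotEquiv_gaussProb R A hR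

/-- **Covariance form: `(dμ_C).map R = dμ_{RCRᵀ}`** for an invertible covariance `C` (precision `C⁻¹`;
`(RCRᵀ)⁻¹ = RC⁻¹Rᵀ` is `B13GaugeDevices.inv_conj`) — print's *«C^{(k)}(U^u) = R(u)C^{(k)}(U)R(u)*»* reading.
[cite: Balaban1987RG1, (2.16) p.269] -/
theorem map_rotEquiv_gaussProb_of_cov (R C : Matrix κ κ ℝ) (hR : Rᵀ * R = 1) (hC : IsUnit C.det) :
    (gaussProb C⁻¹).map ⇑(rotEquiv R hR) = gaussProb (R * C * Rᵀ)⁻¹ := by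
  rw [map_rotEquiv_gaussProb, inv_conj R C hR hC]

/-- The integral form: `∫dμ_{(RARᵀ)⁻¹}(B′)Ψ(B′) = ∫dμ_{A⁻¹}(B)Ψ(RB)` for EVERY `Ψ` (= `gaussMean_conj` read through
`gaussProb`; no integrability needed — change of variables under a measurable equivalence).
[cite: Balaban1987RG1, (2.16) p.269] -/
theorem integral_gaussProb_conj {E : Type*} [NormedAddCommGroup E] [NormedSpace ℝ E] (R A : Matrix κ κ ℝ)
    (hR : Rᵀ * R = 1) (Ψ : (κ → ℝ) → E) :
    ∫ B, Ψ B ∂(gaussProb (R * A * Rᵀ)) = ∫ B, Ψ (R *ᵥ B) ∂(gaussProb A) := by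
  rw [← map_rotEquiv_gaussProb R A hR, integral_map_equiv]
  rfl

/-- The normalised Gaussian with a rotation-invariant precision (`RARᵀ = A`, e.g. `A = 1`) is rotation invariant.
[cite: Balaban1987RG1, (2.16) p.269] -/
theorem map_rotEquiv_gaussProb_of_conj_eq (R A : Matrix κ κ ℝ) (hR : Rᵀ * R = 1) (hA : R * A * Rᵀ = A) :
    (gaussProb A).map ⇑(rotEquiv R hR) = gaussProb A := by
  rw [map_rotEquiv_gaussProb, hA]

/-! ## §4  THE MEASURE CLAUSE OF (2.16): covariant precisions ⇒ covariant measures -/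

section Covariant

variable {X : Type*} {τ : X → X}

/-- **«together with the measure, are invariant» (2.16) — the measure clause AS A THEOREM for Gaussian measures.**
For a family of precisions `prec U` over the background configurations `U : X` and a background map `τ`
(`U_{k+1} ↦ U^u_{k+1}`, or the Euclidean `r` of (2.17)) under which the precision is conjugated by the orthogonal
`R`, `prec (τ U) = R · prec U · Rᵀ`, the fluctuation measures are covariant: `(dμ_U).map R = dμ_{τU}`.  This is
literally the hypothesis `hμ : ∀ U, (D.μ U).map e = D.μ (τ U)` of `B12Eq213Body268.FluctData.integral_eq_of_covariant`
for `μ U := gaussProb (prec U)`, `e := rotEquiv R hR`. [cite: Balaban1987RG1, (2.16) p.269] -/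
theorem gaussProb_map_covariant (R : Matrix κ κ ℝ) (hR : Rᵀ * R = 1) {prec : X → Matrix κ κ ℝ}
    (hprec : ∀ U, prec (τ U) = R * prec U * Rᵀ) (U : X) :
    (gaussProb (prec U)).map ⇑(rotEquiv R hR) = gaussProb (prec (τ U)) := by
  rw [map_rotEquiv_gaussProb, hprec]

/-- The same in the covariance reading: `C(τU) = R C(U) Rᵀ` with `C(U)` invertible, measures `dμ_{C(U)} =
gaussProb (C U)⁻¹`. [cite: Balaban1987RG1, (2.16) p.269 with (2.11)–(2.12) p.268] -/
theorem gaussProb_map_covariant_of_cov (R : Matrix κ κ ℝ) (hR : Rᵀ * R = 1) {cov : X → Matrix κ κ ℝ}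
    (hcov : ∀ U, cov (τ U) = R * cov U * Rᵀ) (hdet : ∀ U, IsUnit (cov U).det) (U : X) :
    (gaussProb (cov U)⁻¹).map ⇑(rotEquiv R hR) = gaussProb (cov (τ U))⁻¹ := by
  rw [map_rotEquiv_gaussProb_of_cov R (cov U) hR (hdet U), hcov]

/-- **«therefore the expression (2.13) is gauge invariant»** at the Gaussian measure: for ANY integrand jointly
invariant under `(τ, R)` — `F(τU, RB) = F(U, B)`, e.g. `χ_k(B) e^{𝐏^{(k)}(g_k,U,B)+{…}}` with `χ_k` *«invariant with
respect to the transformations of the fluctuation field»* and the exponent invariant — the integrals against the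
covariant Gaussian measures agree: `∫dμ_{τU}(B)F(τU,B) = ∫dμ_U(B)F(U,B)`.  (The abstract-datum form is r20's
`FluctData.integral_eq_of_covariant`; this is its Gaussian instance with `hμ` discharged.)
[cite: Balaban1987RG1, (2.16) p.269] -/
theorem integral_gaussProb_covariant {E : Type*} [NormedAddCommGroup E] [NormedSpace ℝ E] (R : Matrix κ κ ℝ)
    (hR : Rᵀ * R = 1) {prec : X → Matrix κ κ ℝ} (hprec : ∀ U, prec (τ U) = R * prec U * Rᵀ)
    (F : X → (κ → ℝ) → E) (hF : ∀ U B, F (τ U) (R *ᵥ B) = F U B) (U : X) :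
    ∫ B, F (τ U) B ∂(gaussProb (prec (τ U))) = ∫ B, F U B ∂(gaussProb (prec U)) := by
  rw [← gaussProb_map_covariant R hR hprec U, integral_map_equiv]
  simp only [rotEquiv_apply, hF]

/-- Iterating the background map (a sequence of gauge transformations): `(dμ_U).map Rⁿ = dμ_{τⁿU}` in the form
`prec (τ^[n] U) = Rⁿ · prec U · (Rⁿ)ᵀ`. [cite: Balaban1987RG1, (2.16) p.269] -/
theorem prec_iterate_covariant (R : Matrix κ κ ℝ) {prec : X → Matrix κ κ ℝ}
    (hprec : ∀ U, prec (τ U) = R * prec U * Rᵀ) (n : ℕ) (U : X) :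
    prec (τ^[n] U) = R ^ n * prec U * (R ^ n)ᵀ := by
  induction n generalizing U with
  | zero => simp
  | succ n ih =>
      rw [Function.iterate_succ_apply', hprec, ih, pow_succ', transpose_mul]
      simp only [Matrix.mul_assoc]

end Covariant

/-! ## §5  Print's precision `C*Δ^{(k)}(U)C`: covariance of `Δ^{(k)}` and the intertwining `C R₂ = R₁ C` -/

section Sandwich

variable {ι : Type*} [Fintype ι] [DecidableEq ι]

/-- If `C R₂ = R₁ C` for orthogonal `R₁`, `R₂`, then `R₁ᵀ C = C R₂ᵀ`. [cite: Balaban1987RG1, (2.16) p.269] -/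
theorem transpose_mul_of_intertwine (Cop : Matrix ι κ ℝ) (R₁ : Matrix ι ι ℝ) (R₂ : Matrix κ κ ℝ)
    (hR₁ : R₁ᵀ * R₁ = 1) (hR₂ : R₂ᵀ * R₂ = 1) (hC : Cop * R₂ = R₁ * Cop) : R₁ᵀ * Cop = Cop * R₂ᵀ := by
  calc R₁ᵀ * Cop = R₁ᵀ * Cop * (R₂ * R₂ᵀ) := by rw [mul_transpose_self_of_transpose_mul_self R₂ hR₂, Matrix.mul_one]
    _ = R₁ᵀ * (Cop * R₂) * R₂ᵀ := by simp only [Matrix.mul_assoc]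
    _ = R₁ᵀ * R₁ * Cop * R₂ᵀ := by rw [hC]; simp only [Matrix.mul_assoc]
    _ = Cop * R₂ᵀ := by rw [hR₁, Matrix.one_mul]

/-- **The letter identity**: `Cᵀ (R₁ Δ R₁ᵀ) C = R₂ (Cᵀ Δ C) R₂ᵀ` when `C R₂ = R₁ C` and `R₁`, `R₂` are orthogonal —
conjugating `Δ^{(k)}` by `R(u)` on the `B′`-variables conjugates `C*Δ^{(k)}C` by `R(u)` on the `B`-variables.
[cite: Balaban1987RG1, (2.16) p.269 with (2.11)–(2.12) p.268] -/
theorem sandwich_conj_of_intertwine (Cop : Matrix ι κ ℝ) (R₁ : Matrix ι ι ℝ) (R₂ : Matrix κ κ ℝ)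
    (hR₁ : R₁ᵀ * R₁ = 1) (hR₂ : R₂ᵀ * R₂ = 1) (hC : Cop * R₂ = R₁ * Cop) (Δ : Matrix ι ι ℝ) :
    Copᵀ * (R₁ * Δ * R₁ᵀ) * Cop = R₂ * (Copᵀ * Δ * Cop) * R₂ᵀ := by
  have h1 : R₁ᵀ * Cop = Cop * R₂ᵀ := transpose_mul_of_intertwine Cop R₁ R₂ hR₁ hR₂ hC
  have h2 : Copᵀ * R₁ = R₂ * Copᵀ := by
    have h := congrArg Matrix.transpose h1
    simpa only [transpose_mul, transpose_transpose] using h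
  calc Copᵀ * (R₁ * Δ * R₁ᵀ) * Cop = Copᵀ * R₁ * Δ * (R₁ᵀ * Cop) := by simp only [Matrix.mul_assoc]
    _ = R₂ * Copᵀ * Δ * (Cop * R₂ᵀ) := by rw [h2, h1]
    _ = R₂ * (Copᵀ * Δ * Cop) * R₂ᵀ := by simp only [Matrix.mul_assoc]

variable {X : Type*} {τ : X → X}

/-- **Print's precision is covariant**: `Δ^{(k)}(τU) = R₁ Δ^{(k)}(U) R₁ᵀ` and `C R₂ = R₁ C` give
`Cᵀ Δ^{(k)}(τU) C = R₂ (Cᵀ Δ^{(k)}(U) C) R₂ᵀ` — the hypothesis `hprec` of §4 for the letters `Cᵀ · Δ U · C` of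
`B12Eq213Body268.prec212_def`. [cite: Balaban1987RG1, (2.16) p.269 with (2.11)–(2.12) p.268] -/
theorem prec_sandwich_covariant (Cop : Matrix ι κ ℝ) (R₁ : Matrix ι ι ℝ) (R₂ : Matrix κ κ ℝ)
    (hR₁ : R₁ᵀ * R₁ = 1) (hR₂ : R₂ᵀ * R₂ = 1) (hC : Cop * R₂ = R₁ * Cop) {Δ : X → Matrix ι ι ℝ}
    (hΔ : ∀ U, Δ (τ U) = R₁ * Δ U * R₁ᵀ) (U : X) :
    Copᵀ * Δ (τ U) * Cop = R₂ * (Copᵀ * Δ U * Cop) * R₂ᵀ := by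
  rw [hΔ]
  exact sandwich_conj_of_intertwine Cop R₁ R₂ hR₁ hR₂ hC (Δ U)

/-- **THE MEASURE CLAUSE OF (2.16) FOR PRINT'S GAUSSIAN `dμ_{C^{(k)}(U)}`, `C^{(k)}(U) = (C*Δ^{(k)}(U)C)⁻¹`**: under
the covariance of `Δ^{(k)}` and the intertwining of the two orthogonal actions by the elimination map `C`, the
transformation `B ↦ R₂B` carries `dμ_{C^{(k)}(U)}` to `dμ_{C^{(k)}(τU)}`. [cite: Balaban1987RG1, (2.16) p.269] -/
theorem gaussProb_sandwich_map_covariant (Cop : Matrix ι κ ℝ) (R₁ : Matrix ι ι ℝ) (R₂ : Matrix κ κ ℝ)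
    (hR₁ : R₁ᵀ * R₁ = 1) (hR₂ : R₂ᵀ * R₂ = 1) (hC : Cop * R₂ = R₁ * Cop) {Δ : X → Matrix ι ι ℝ}
    (hΔ : ∀ U, Δ (τ U) = R₁ * Δ U * R₁ᵀ) (U : X) :
    (gaussProb (Copᵀ * Δ U * Cop)).map ⇑(rotEquiv R₂ hR₂) = gaussProb (Copᵀ * Δ (τ U) * Cop) :=
  gaussProb_map_covariant R₂ hR₂ (prec := fun U => Copᵀ * Δ U * Cop)
    (fun U => prec_sandwich_covariant Cop R₁ R₂ hR₁ hR₂ hC hΔ U) U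

/-- … and every jointly invariant integral against it is an invariant function of the background (the Gaussian
instance of *«therefore the expression (2.13) is gauge invariant»* at print's precision).
[cite: Balaban1987RG1, (2.16) p.269] -/
theorem integral_gaussProb_sandwich_covariant {E : Type*} [NormedAddCommGroup E] [NormedSpace ℝ E]
    (Cop : Matrix ι κ ℝ) (R₁ : Matrix ι ι ℝ) (R₂ : Matrix κ κ ℝ) (hR₁ : R₁ᵀ * R₁ = 1) (hR₂ : R₂ᵀ * R₂ = 1)
    (hC : Cop * R₂ = R₁ * Cop) {Δ : X → Matrix ι ι ℝ} (hΔ : ∀ U, Δ (τ U) = R₁ * Δ U * R₁ᵀ)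
    (F : X → (κ → ℝ) → E) (hF : ∀ U B, F (τ U) (R₂ *ᵥ B) = F U B) (U : X) :
    ∫ B, F (τ U) B ∂(gaussProb (Copᵀ * Δ (τ U) * Cop)) = ∫ B, F U B ∂(gaussProb (Copᵀ * Δ U * Cop)) :=
  integral_gaussProb_covariant R₂ hR₂ (prec := fun U => Copᵀ * Δ U * Cop)
    (fun U => prec_sandwich_covariant Cop R₁ R₂ hR₁ hR₂ hC hΔ U) F hF U

end Sandwich

end Literature.MathematicalPhysics.QuantumFieldTheory.Balaban1983to89.B12Eq216MeasureCovariance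

end
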